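import Summits.AtomisticToContinuum.HydrodynamicLimit.Theorems.AntiMazurCoboundariesInfluenceLocalityTrueCapsExistPrelimB
import Summits.AtomisticToContinuum.HydrodynamicLimit.Theorems.AntiMazurCoboundariesInfluenceLocalityTrueCapsExistPrelimC
import Summits.AtomisticToContinuum.HydrodynamicLimit.Theorems.BoltzmannGreenKubo.Negative.Stationarity

/-!
# Prelim E of stub `stub_trueCapsExist` (line `true-anchored-infection`, crux `InfluenceLocality`,
# stmt-AtomisticToContinuum-13916; route AntiMazurCoboundaries): the localised Rice bound for the
# fast collisions of a sphere `j` near the anchor sphere `i`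

Companion of Prelim D (`trueCaps_rice_self`). For `j ≠ i` the mark of STUB 4 is "sphere `j`
collides, is fast afterwards (`u < ‖v_j - c‖`) and lies within `ρ + (‖v_j‖ + V) τ` of sphere `i`"
(the summand produced by the flight-start alternative `trueCaps_fast_decomp`). Its one-window
majorant read at the grid time after the collision has the radius enlarged by the backward flight,
`ρ̃ = ρ + (‖v_j‖ + V) τ + τ (‖v_j‖ + ‖v_i‖)` (`Torus.euclidDist_le_euclidDist_translate`), and the
collision-flux inequality `measure_collisionSum_ge_le_liminf` under the stationary law
`G_N = gibbs σ a θ c N Φ` gives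

* `trueCaps_rice_other` (registered prelim) —
  `G_N{good, sum ≥ 1} ≤ 16 ε² τ · I_fast + 32 (N+1) ε² τ · vol(B₁) · J₃`,
  `J₃ = TrueCaps.nearFlux c θ u ρ V τ = ∫ ‖v_k - v_j‖ ρ̃(v_j, v_i)³ 𝟙{u < ‖v_j - c‖} d(γ ⊗ γ ⊗ γ)`:
  the partner `k = i` is handled by the pair events of `exists_windowEvent` (dropping the
  localisation), the partners `k ∉ {i, j}` by the localised window bound `trueCaps_window_ball_le`
  (three-label Ruelle bound), whose factor `vol(ball of radius ρ̃) ∝ ℓ³` compensates the sum over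
  `j` in the assembly, as `ε²` compensates the sum over `k`.
-/

namespace Summit.AtomisticToContinuum.HydrodynamicLimit.Theorems.TrueAnchoredInfection

open MeasureTheory Set Filter Topology
open scoped ENNReal
open Literature.Analysis.FluidPDE Literature.MathematicalPhysics.KineticTheory
open Literature.Analysis.FunctionSpaces
open Summit.AtomisticToContinuum.HydrodynamicLimit.Theorems.BoltzmannGreenKuboOrthMomentum
  (measurePreserving_flow_localGibbsLaw)

noncomputable section

namespace TrueCaps

/-- A backward flight time of a window is at most the horizon: `t ≤ τ / M → t ≤ τ` (`τ ≥ 0`). -/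
theorem le_of_le_div_natCast {t τ : ℝ} (hτ : 0 ≤ τ) {M : ℕ} (ht : t ≤ τ / M) : t ≤ τ := by
  rcases Nat.eq_zero_or_pos M with rfl | hM
  · simp only [Nat.cast_zero, div_zero] at ht; exact ht.trans hτ
  · exact ht.trans (div_le_self hτ (by exact_mod_cast hM))

/-- **The majorant along a backward flight.** If after the backward free flight of duration
`t ∈ [0, τ]` sphere `j` lies within `r` of sphere `i`, then before it `j` lies within
`r + τ (‖v_j‖ + ‖v_i‖)` of `i`. -/
theorem euclidDist_le_of_freeFlight_neg {N : ℕ} (w : Phase N) (j i : Fin (N + 1)) {t τ r : ℝ}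
    (ht0 : 0 ≤ t) (htτ : t ≤ τ)
    (h : Torus.euclidDist (freeFlight G3 (-t) w j).1 (freeFlight G3 (-t) w i).1 < r) :
    Torus.euclidDist (w j).1 (w i).1 < r + τ * (‖(w j).2‖ + ‖(w i).2‖) := by
  have h1 := Torus.euclidDist_le_euclidDist_translate (w j).1 (w i).1 ((-t) • (w j).2) ((-t) • (w i).2)
  simp only [freeFlight_apply, Torus.geometry_translate] at h
  have h2 : ‖(-t) • (w j).2 - (-t) • (w i).2‖ ≤ τ * (‖(w j).2‖ + ‖(w i).2‖) := by
    rw [← smul_sub, norm_smul, Real.norm_eq_abs, abs_neg, abs_of_nonneg ht0]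
    exact mul_le_mul htτ (norm_sub_le _ _) (norm_nonneg _) (ht0.trans htτ)
  linarith

end TrueCaps

open TrueCaps in
/-- **Registered prelim `trueCaps_rice_other`** (of `stub_trueCapsExist`): the localised Rice bound.
Under `G_N = gibbs σ a θ c N Φ` at small reduced density (`a, θ > 0`, `N ≥ 1`, `τ > 0`,
`ρ, V ≥ 0`, `j ≠ i`), the probability that a good orbit has, at some collision time of `[0, τ]`,
sphere `j` in contact, fast (`u < ‖v_j - c‖`) and within `ρ + (‖v_j‖ + V) τ` of sphere `i` is at
most `16 ε² τ · I_fast + 32 (N+1) ε² τ · vol(B₁) · J₃` (`ε = hsDiameter σ N`,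
`I_fast = TrueCaps.fastFlux c θ u`, `J₃ = TrueCaps.nearFlux c θ u ρ V τ`). -/
theorem trueCaps_rice_other : ∀ (σ a θ : ℝ) (c : V3) (N : ℕ) (Φ : Flow σ N) (τ u ρ V : ℝ) (i j : Fin (N + 1)), SmallDensity uniformProfile σ → 0 < a → 0 < θ → 1 ≤ N → 0 < τ → 0 ≤ ρ → 0 ≤ V → j ≠ i → gibbs σ a θ c N Φ {z | z ∈ Φ.good ∧ 1 ≤ TrueCaps.collSum Φ τ (fun w j' _ => if j' = j ∧ (u < ‖(w j).2 - c‖ ∧ Torus.euclidDist (w j).1 (w i).1 < ρ + (‖(w j).2‖ + V) * τ) then 1 else 0) z} ≤ ENNReal.ofReal (16 * hsDiameter σ N ^ 2 * τ) * TrueCaps.fastFlux c θ u + ENNReal.ofReal (32 * (N + 1) * hsDiameter σ N ^ 2 * τ) * MeasureTheory.volume (Metric.ball (0 : V3) 1) * TrueCaps.nearFlux c θ u ρ V τ := by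
  intro σ a θ c N Φ τ u ρ V i j hsd ha hθ hN hτ hρ hV hji
  classical
  set P := gibbs σ a θ c N Φ with hP
  set ε := hsDiameter σ N with hε
  have hε0 : 0 < ε := hsDiameter_pos hsd.σ_pos N
  -- the mark, its majorant and the weights
  set F : Phase N → Fin (N + 1) → Fin (N + 1) → ℝ≥0∞ := fun w j' _ =>
    if j' = j ∧ (u < ‖(w j).2 - c‖ ∧ Torus.euclidDist (w j).1 (w i).1 < ρ + (‖(w j).2‖ + V) * τ) then 1 else 0 with hF
  set Ft : Phase N → Fin (N + 1) → Fin (N + 1) → ℝ≥0∞ := fun w j' _ =>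
    if j' = j ∧ (u < ‖(w j).2 - c‖ ∧ Torus.euclidDist (w j).1 (w i).1 < nearRadius ρ V τ ((w j).2, (w i).2)) then 1 else 0
    with hFt
  set A : V3 × V3 → ℝ≥0∞ := fun p => {p : V3 × V3 | u < ‖p.1 - c‖}.indicator 1 p with hA
  have hAm : Measurable A := measurable_fastWeight c u
  set W : (V3 × V3) × V3 → ℝ≥0∞ := fun q => {q : (V3 × V3) × V3 | u < ‖q.1.1 - c‖}.indicator 1 q with hW
  have hWm : Measurable W := measurable_fastWeight₃ c u
  -- the events: pair events for the partner `i`, tube events for the other partners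
  obtain ⟨E₂, hE₂m, hE₂c, hE₂b⟩ := exists_pairEvents hsd ha hθ c hN Φ hτ j hAm
  have htube : ∀ M : ℕ, ∃ S : V3 → Set V3, MeasurableSet {q : V3 × V3 | q.1 ∈ S q.2} ∧
      (∀ v, volume (S v) ≤ ENNReal.ofReal (4 * ε ^ 2 * (τ / M) * ‖v‖)) ∧
      ∀ (v r : V3) (s : ℝ), ε ≤ ‖r‖ → s ∈ Icc 0 (τ / M) → ‖r + s • v‖ = ε → r ∈ S v :=
    fun M => exists_sweptTube hε0 (div_nonneg hτ.le (Nat.cast_nonneg M))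
  choose S hSm hSvol hS using htube
  set E' : ℕ → Fin (N + 1) → Fin (N + 1) → Set (Phase N) := fun M j' k =>
    if j' = j then (if k = i then E₂ M i else windowEvent (S M) j k) else univ with hE'
  have hE'm : ∀ M j' k, MeasurableSet (E' M j' k) := by
    intro M j' k
    by_cases h : j' = j
    · simp only [hE', if_pos h]
      by_cases hk : k = i
      · simp only [if_pos hk]; exact hE₂m M i
      · simp only [if_neg hk]; exact measurableSet_windowEvent (hSm M) j k
    · simp only [hE', if_neg h]; exact MeasurableSet.univ
  have hE'c : ∀ (M : ℕ) (j' k : Fin (N + 1)), j' ≠ k → ∀ w ∈ hardSphereDomain G3 (N + 1) ε, ∀ t ∈ Icc 0 (τ / M),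
      ‖G3.sepVec ((freeFlight G3 (-t) w j').1) ((freeFlight G3 (-t) w k).1)‖ = ε → w ∈ E' M j' k := by
    intro M j' k hjk w hw t ht hc
    by_cases h : j' = j
    · subst h
      simp only [hE', if_true]
      by_cases hk : k = i
      · subst hk
        simp only [if_true]
        exact hE₂c M k hjk w hw t ht hc
      · simp only [if_neg hk]
        exact mem_windowEvent_of_contact (hS M) hjk hw ht hc
    · simp only [hE', if_neg h]; exact mem_univ _
  have hFtm : ∀ M (j' k : Fin (N + 1)), Measurable fun w => (fun (_ : ℕ) => Ft) M w j' k := by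
    intro M j' k
    by_cases h : j' = j
    · subst h
      simp only [hFt, true_and]
      refine Measurable.ite ?_ measurable_const measurable_const
      refine (measurableSet_lt measurable_const ((measurable_pi_apply j').snd.sub measurable_const).norm).inter ?_
      refine measurableSet_lt ?_ ((measurable_nearRadius ρ V τ).comp
        ((measurable_pi_apply j').snd.prodMk (measurable_pi_apply i).snd))
      exact (Torus.measurable_reprSym.comp ((measurable_pi_apply j').fst.sub (measurable_pi_apply i).fst)).norm
    · have : (fun w : Phase N => Ft w j' k) = fun _ => 0 := by
        funext w; simp only [hFt, h, false_and, if_false]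
      simp only [this]
      exact measurable_const
  have hFFt : ∀ (M : ℕ) (j' k : Fin (N + 1)), j' ≠ k → ∀ w ∈ hardSphereDomain G3 (N + 1) ε, ∀ t ∈ Icc 0 (τ / M),
      ‖G3.sepVec ((freeFlight G3 (-t) w j').1) ((freeFlight G3 (-t) w k).1)‖ = ε →
        F (freeFlight G3 (-t) w) j' k ≤ (fun (_ : ℕ) => Ft) M w j' k := by
    intro M j' k _ w _ t ht _
    simp only [hF, hFt]
    by_cases h : j' = j ∧ (u < ‖(freeFlight G3 (-t) w j).2 - c‖ ∧
        Torus.euclidDist (freeFlight G3 (-t) w j).1 (freeFlight G3 (-t) w i).1 < ρ + (‖(freeFlight G3 (-t) w j).2‖ + V) * τ)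
    · rw [if_pos h, if_pos]
      refine ⟨h.1, ?_, ?_⟩
      · simpa only [freeFlight_apply] using h.2.1
      · have h3 := euclidDist_le_of_freeFlight_neg w j i ht.1 (le_of_le_div_natCast hτ.le ht.2) h.2.2
        simpa only [nearRadius, freeFlight_apply] using h3
    · rw [if_neg h]; exact bot_le
  have hstat : ∀ t : ℝ, MeasurePreserving (Φ.flow t) P P := fun t => measurePreserving_flow_localGibbsLaw a θ c Φ t
  have hgen := measure_collisionSum_ge_le_liminf Φ P hstat hτ F E' hE'm hE'c (fun _ => Ft) hFtm hFFt
    one_ne_zero ENNReal.one_ne_top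
  rw [inv_one, one_mul] at hgen
  refine hgen.trans (liminf_le_of_frequently_le' (Frequently.of_forall fun M => ?_))
  -- the one-window bounds
  set pairB : ℝ≥0∞ := ENNReal.ofReal (16 * ε ^ 2 * (τ / M)) * fastFlux c θ u with hpairB
  set tripB : ℝ≥0∞ := ENNReal.ofReal (32 * ε ^ 2 * (τ / M)) * volume (Metric.ball (0 : V3) 1) * nearFlux c θ u ρ V τ
    with htripB
  have hpair : ∫⁻ w, (E₂ M i).indicator (fun w => Ft w j i) w ∂P ≤ pairB := by
    refine le_trans (lintegral_mono fun w => ?_) (hE₂b M i hji)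
    refine indicator_le_indicator ?_
    simp only [hFt, hA, true_and, indicator, mem_setOf_eq, Pi.one_apply]
    by_cases h1 : u < ‖(w j).2 - c‖
    · simp only [h1, true_and, if_true]
      split_ifs <;> simp
    · simp only [h1, false_and, if_false, le_refl]
  have htrip : ∀ k, k ≠ i → j ≠ k → ∫⁻ w, (windowEvent (S M) j k).indicator (fun w => Ft w j k) w ∂P ≤ tripB := by
    intro k hki hjk
    have heq : (fun w => (windowEvent (S M) j k).indicator (fun w => Ft w j k) w) =
        (windowEvent (S M) j k ∩ {w : Phase N | Torus.euclidDist (w j).1 (w i).1 < nearRadius ρ V τ ((w j).2, (w i).2)}).indicator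
          fun w => W (((w j).2, (w k).2), (w i).2) := by
      funext w
      simp only [hFt, hW, true_and, indicator, mem_inter_iff, mem_setOf_eq, Pi.one_apply]
      by_cases h1 : w ∈ windowEvent (S M) j k
      · by_cases h2 : u < ‖(w j).2 - c‖
        · by_cases h3 : Torus.euclidDist (w j).1 (w i).1 < nearRadius ρ V τ ((w j).2, (w i).2)
          · simp [h1, h2, h3]
          · simp [h1, h2, h3]
        · simp [h1, h2]
      · simp [h1]
    rw [heq]
    have key := trueCaps_window_ball_le σ a θ c N Φ (τ / M) j k i (S M) W (nearRadius ρ V τ) hsd ha hθ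
      (div_nonneg hτ.le (Nat.cast_nonneg M)) hjk hji hki (hSm M) (hSvol M) hWm (measurable_nearRadius ρ V τ)
      (nearRadius_nonneg hρ hV hτ.le)
    exact key
  have hterm : ∀ j' k : Fin (N + 1), ∫⁻ w, (if j' ≠ k then (E' M j' k).indicator (fun w => Ft w j' k) w else 0) ∂P ≤
      if j' = j then ((if k = i then pairB else 0) + tripB) else 0 := by
    intro j' k
    by_cases hjk : j' ≠ k
    · simp only [if_pos hjk]
      by_cases h : j' = j
      · subst h
        simp only [if_true, hE']
        by_cases hk : k = i
        · subst hk
          simp only [if_true]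
          exact hpair.trans le_self_add
        · simp only [if_neg hk, zero_add]
          exact htrip k hk hjk
      · have h0 : (fun w => (E' M j' k).indicator (fun w => Ft w j' k) w) = fun _ => 0 := by
          funext w
          simp only [hFt, h, false_and, if_false]
          exact Set.indicator_apply_eq_zero.2 fun _ => rfl
        rw [h0, lintegral_zero]
        simp [h]
    · simp only [if_neg hjk, lintegral_zero]
      exact bot_le
  have hmeas : ∀ j' k : Fin (N + 1), Measurable fun w : Phase N =>
      (if j' ≠ k then (E' M j' k).indicator (fun w => Ft w j' k) w else 0) := by
    intro j' k
    by_cases hjk : j' ≠ k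
    · simp only [if_pos hjk]; exact (hFtm M j' k).indicator (hE'm M j' k)
    · simp only [if_neg hjk]; exact measurable_const
  calc (M : ℝ≥0∞) * ∫⁻ w, ∑ j', ∑ k, (if j' ≠ k then (E' M j' k).indicator (fun w => Ft w j' k) w else 0) ∂P
      = (M : ℝ≥0∞) * ∑ j', ∑ k, ∫⁻ w, (if j' ≠ k then (E' M j' k).indicator (fun w => Ft w j' k) w else 0) ∂P := by
        congr 1
        rw [lintegral_finsetSum _ fun j' _ => Finset.measurable_sum _ fun k _ => hmeas j' k]
        exact Finset.sum_congr rfl fun j' _ => lintegral_finsetSum _ fun k _ => hmeas j' k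
    _ ≤ (M : ℝ≥0∞) * ∑ j' : Fin (N + 1), ∑ k : Fin (N + 1),
          (if j' = j then ((if k = i then pairB else 0) + tripB) else 0) := by
        gcongr with j' _ k _
        exact hterm j' k
    _ = (M : ℝ≥0∞) * (pairB + (N + 1) * tripB) := by
        congr 1
        rw [Finset.sum_eq_single j (fun j' _ hj' => by simp [hj']) (fun h => absurd (Finset.mem_univ j) h)]
        simp only [if_true, Finset.sum_add_distrib, Finset.sum_ite_eq', Finset.mem_univ, if_true, Finset.sum_const,
          Finset.card_univ, Fintype.card_fin, nsmul_eq_mul, Nat.cast_add, Nat.cast_one]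
    _ = (M : ℝ≥0∞) * ENNReal.ofReal (16 * ε ^ 2 * (τ / M)) * fastFlux c θ u +
          (N + 1) * ((M : ℝ≥0∞) * ENNReal.ofReal (32 * ε ^ 2 * (τ / M))) * volume (Metric.ball (0 : V3) 1) *
            nearFlux c θ u ρ V τ := by
        rw [hpairB, htripB]; ring
    _ ≤ ENNReal.ofReal (16 * ε ^ 2 * τ) * fastFlux c θ u +
          (N + 1) * ENNReal.ofReal (32 * ε ^ 2 * τ) * volume (Metric.ball (0 : V3) 1) * nearFlux c θ u ρ V τ := by
        gcongr
        · exact natCast_mul_ofReal_div_le M _ _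
        · exact natCast_mul_ofReal_div_le M _ _
    _ = ENNReal.ofReal (16 * ε ^ 2 * τ) * fastFlux c θ u +
          ENNReal.ofReal (32 * (N + 1) * ε ^ 2 * τ) * volume (Metric.ball (0 : V3) 1) * nearFlux c θ u ρ V τ := by
        congr 2
        have hN1 : ((N : ℝ≥0∞) + 1) = ENNReal.ofReal ((N : ℝ) + 1) := by
          rw [ENNReal.ofReal_add (Nat.cast_nonneg _) zero_le_one, ENNReal.ofReal_natCast, ENNReal.ofReal_one]
        rw [hN1, ← ENNReal.ofReal_mul (by positivity)]
        congr 1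
        ring

end

end Summit.AtomisticToContinuum.HydrodynamicLimit.Theorems.TrueAnchoredInfection
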